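import Summits.QuantumFields.YangMills.Theorems.UnitScaleTiltProp7LocalLaplacianGaugeCovariance
import Summits.QuantumFields.YangMills.Theorems.UnitScaleTiltProp7TopMeanGaugeCovariance
import Summits.QuantumFields.YangMills.Theorems.UnitScaleTiltProp7ProjectorGaugeCovariance
import Summits.QuantumFields.YangMills.Theorems.UnitScaleTiltProp7ProjectorPerturbationLocal
import HarnessLib

/-!
# Route `UnitScaleTilt`, crux K1 «MinimiserStabilityRegPr» (stmt-QuantumFields-19200), EX row `hGF[Lift]` (curved member) — **LOD LINE, PEN (L5″) FILE 2z (MEMBER KNIT):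
# THE `P`-TERM OF ORGANISATION I UNDER THE LOCAL GAUGE COMPARISON** — (step 0) the `P`-term `‖D*_UÃ − R_U D*_UÃ‖`, `R_U = projR (Δ^η_U) Q″_U` print's (3.21) projector of the
# averaging of record, is a GAUGE INVARIANT of `(U₀, A)` (✓`Prop7ProjectorGaugeCovariance` ∘ px12 ✓`Prop7LocalLaplacianGaugeCovariance` ∘ ✓`Prop7TopMeanGaugeCovariance`); (knit) given
# the ONE local projector row (R-P) at the gauged background `W = U₀^σ` against the flat system, the Step I.2 (L5″) comparison in the chair's RELATIVE currency:
# `|‖P_{U₀}(D*_{U₀}Ã)‖² − ‖P_1(∂*(Ad_σA)~)‖²| ≤ (δ_P + θ)·‖D*_{U₀}Ã‖² + (1 + θ⁻¹)·12η⁻²δ²·‖Ã‖²` for `‖W(b) − 1‖ ≤ δ` on `supp A`.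

Cell `ym3-torus` (HUMAN RULING D-0037, YM ladder rung R3 — NOT d = 4, NOT infinite volume, NOT a mass gap, NOT Clay).  Width seat `ym-routeR-w3` gen 12; ★p1 g24
LOCATE-L6-ASSEMBLY §1 Step I.2 (L5″), road (α) 2026-08-29 23:17:20Z; this seat's LOCATE-L5pp-FILE2 (bce81fab) §2.  THEOREMS ONLY (0 `def`, 0 `sorry`);
`--supports stmt-QuantumFields-19200 --as helper`, count-neutral.  HONEST LABEL (★★OWNER RULING №33 (6)): curved γ-row supplier line (LOD localisation), pen (L5″); this is the KNIT
— the analytic content is the displayed hypothesis `hloc` (the (R-P) row: rows (R-B)(R-N) of the LOCATE through ✓`Prop7ProjectorPerturbationLocal.norm_inner_proj_sub_proj_le`, suppliers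
px5 (M-I)∕(M-II) + ✓`Prop7CutoffResolventComparison`, routeR-w2 B1∕B2, ✓`Prop7GramConjAccretive`); nothing of (3.49), Thm 3.1∕3.3, `h349`, `hGF`, EX ∕ 19200 is proved here.

WHAT IS PROVED (ns `Summit.QuantumFields.YangMills.Theorems.Prop7PTermLocalGaugeKnit`).
* §0 (lit `projR`, any `Δ`, `Q`): `re_inner_projR_eq_normSq` (`Re⟪g, Rg⟫ = ‖Rg‖²`), `normSq_sub_projR_eq` (`‖g − Rg‖² = ‖g‖² − ‖Rg‖²` — Organisation I's first line),
  `re_inner_sub_projR_eq_normSq` (`Re⟪g, g − Rg⟫ = ‖g − Rg‖²`), `norm_sub_projR_le` (`‖g − Rg‖ ≤ ‖g‖`).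
* §1 `hseq_of_htop` (adapter: the universal top-mean clause (iii) ⟹ the existential one, by ✓`exists_linear_avgSeq`); ★★★ `norm_Pterm_gaugeAct_eq` — STEP 0: for an `SU(2)` gauge transformation `σ` and averaging-of-record maps `Q″₀` at `U₀`, `Q″₁` at `U₀^σ`:
  `‖D*_{U₀^σ}(Ad_σX)~ − R_{U₀^σ}(D*_{U₀^σ}(Ad_σX)~)‖ = ‖D*_{U₀}X̃ − R_{U₀}(D*_{U₀}X̃)‖` and the same for the `R`-terms.
* §2 ★★★ `abs_normSq_Pterm_sub_flat_le` — THE (L5″) ROW OF STEP I.2 modulo the local projector row `hloc` at `(U₀^σ, 1)`.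

References: T. Bałaban, CMP **99** (1985) 389–434 [Balaban1985BackgroundPropagators] ((3.8) p.392, (3.20)–(3.23) p.394, p.393, (3.49) p.399); CMP **98** (1985) 17–51
[Balaban1985Averaging] ((11) p.19); CMP **99** (1985) 75–102 [Balaban1985RegularSpaces] (Lemma 1 (1.25) p.79).
-/

set_option autoImplicit false

noncomputable section

open scoped BigOperators Matrix.Norms.L2Operator InnerProductSpace ComplexConjugate

namespace Summit.QuantumFields.YangMills.Theorems.Prop7PTermLocalGaugeKnit

open Literature.MathematicalPhysics.QuantumFieldTheory.Balaban1983to89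
open Literature.MathematicalPhysics.QuantumFieldTheory.Balaban1983to89.T3ContinuumYM3Torus
open T4Continuum BlockAveraging
open BlockAveraging (Idx)
open B7Prop1Explicit (disp)
open B10Eq27TorusAxialLog (holT transl)
open B7TransferAnalyticMean (meanCLM)
open B15DeterminingSets (embIter)
open B11Eq103H1Complex (SiteL2K BondL2K projR projR_isSymmetric projR_projR)
open Summit.QuantumFields.YangMills.Theorems.Prop8Chart (emlIterU)
open T3SectALandauChart (eta eta_pos bgUnits)
open Summit.QuantumFields.YangMills.Theorems.Prop7SectET3Transport (periodsT3)
open Summit.QuantumFields.YangMills.Theorems.Prop7SectET3HilbertLetters (W₂ toL2 toL2S DstarL2 covLapSite)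
open Summit.QuantumFields.YangMills.Theorems.Prop7LocalDivergenceComparison (normSq_DstarL2_sub_DstarL2_one_le norm_toL2_conj_eq)
open Summit.QuantumFields.YangMills.Theorems.Prop7LocalLaplacianGaugeCovariance (exists_adIsometries)
open Summit.QuantumFields.YangMills.Theorems.Prop7TopMeanGaugeCovariance (topMean_gaugeAct_conj)
open Summit.QuantumFields.YangMills.Theorems.Prop7ProjectorGaugeCovariance (ker_eq_map_of_conj norm_sub_projR_adjoint_conj)
open Summit.QuantumFields.YangMills.Theorems.Prop7ProjectorPerturbationLocal (abs_re_inner_sub_le_relative)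
open Summit.QuantumFields.YangMills.Theorems.Prop7RTermFloor (complex_re_inner_self)

/-! ## §0 Print's `R` and `P = 1 − R`: the quadratic forms (any `Δ`, `Q`) -/

section Proj

variable {E : Type*} [NormedAddCommGroup E] [InnerProductSpace ℂ E] [FiniteDimensional ℂ E] {F' : Type*} [AddCommGroup F'] [Module ℂ F']

/-- `Re⟪g, Rg⟫ = ‖Rg‖²` for print's projector `R = projR Δ Q` (symmetric idempotent: `⟪Rg,Rg⟫ = ⟪g,RRg⟫ = ⟪g,Rg⟫`). [cite: Balaban1985BackgroundPropagators, (3.21) p.394] -/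
theorem re_inner_projR_eq_normSq (Δ : E →ₗ[ℂ] E) (Q : E →ₗ[ℂ] F') (g : E) : (⟪g, projR Δ Q g⟫_ℂ).re = ‖projR Δ Q g‖ ^ 2 := by
  have h1 : ⟪projR Δ Q g, g⟫_ℂ = ⟪g, projR Δ Q g⟫_ℂ := projR_isSymmetric Δ Q g g
  have h2 : ⟪projR Δ Q (projR Δ Q g), g⟫_ℂ = ⟪projR Δ Q g, projR Δ Q g⟫_ℂ := projR_isSymmetric Δ Q _ g
  rw [projR_projR] at h2
  rw [← h1, h2, complex_re_inner_self]

/-- **ORGANISATION I's FIRST LINE**: `‖g − Rg‖² = ‖g‖² − ‖Rg‖²`. [cite: Balaban1985BackgroundPropagators, (3.20)–(3.21) p.394] -/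
theorem normSq_sub_projR_eq (Δ : E →ₗ[ℂ] E) (Q : E →ₗ[ℂ] F') (g : E) : ‖g - projR Δ Q g‖ ^ 2 = ‖g‖ ^ 2 - ‖projR Δ Q g‖ ^ 2 := by
  rw [@norm_sub_sq ℂ, RCLike.re_to_complex, re_inner_projR_eq_normSq]; ring

/-- `Re⟪g, g − Rg⟫ = ‖g − Rg‖²`. [cite: Balaban1985BackgroundPropagators, (3.20)–(3.21) p.394] -/
theorem re_inner_sub_projR_eq_normSq (Δ : E →ₗ[ℂ] E) (Q : E →ₗ[ℂ] F') (g : E) : (⟪g, g - projR Δ Q g⟫_ℂ).re = ‖g - projR Δ Q g‖ ^ 2 := by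
  rw [inner_sub_right, Complex.sub_re, re_inner_projR_eq_normSq, normSq_sub_projR_eq, complex_re_inner_self]

/-- `‖g − Rg‖ ≤ ‖g‖` (`P = 1 − R` is a contraction). [cite: Balaban1985BackgroundPropagators, (3.20)–(3.21) p.394] -/
theorem norm_sub_projR_le (Δ : E →ₗ[ℂ] E) (Q : E →ₗ[ℂ] F') (g : E) : ‖g - projR Δ Q g‖ ≤ ‖g‖ := by
  have h := normSq_sub_projR_eq Δ Q g
  nlinarith [sq_nonneg ‖projR Δ Q g‖, norm_nonneg (g - projR Δ Q g), norm_nonneg g]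

end Proj

/-! ## §1 Step 0: the `P`-term and the `R`-term are gauge invariants of `(U₀, A)` -/

section Member

variable (F : T3Family) {n K : ℕ} (c₀ : ℝ) [Fact (0 < c₀)]

omit [Fact (0 < c₀)] in
/-- **ADAPTER `htop ⟹ hseq`**: the UNIVERSAL top-mean clause (iii) of ✓`exists_intertwiner_of_regPr` (the `htop` of ✓`RS_eq_projR_iff_lift` ∕ ★p1's γ-row door `hT`) implies the
EXISTENTIAL clause used by ✓`Prop7TopMeanGaugeCovariance` and by this file, because averaging sequences exist for every start (✓`Prop7NSIntertwinerOfRecord.exists_linear_avgSeq`).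
[cite: Balaban1985BackgroundPropagators, (3.19) p.393; Balaban1985Averaging, (97) p.32] -/
theorem hseq_of_htop (U₀ : GaugeField (F.P K) 0 (Matrix.specialUnitaryGroup (Fin 2) ℂ))
    (Q'' : SiteL2K ℂ 3 (periodsT3 F K) c₀ W₂ →ₗ[ℂ] (Site (F.P K) (K - n) → Matrix (Fin 2) (Fin 2) ℂ))
    (htop : ∀ (lam : Site (F.P K) 0 → Matrix (Fin 2) (Fin 2) ℂ) (ns : (j : ℕ) → Site (F.P K) j → Matrix (Fin 2) (Fin 2) ℂ), ns 0 = lam →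
      (∀ (j : ℕ) (y : Site (F.P K) (j + 1)), ns (j + 1) y = ns j (emb y) - meanCLM (Idx (F.P K)) (Matrix (Fin 2) (Fin 2) ℂ) fun i : Idx (F.P K) =>
        ns j (emb y) - ((holT (emlIterU j (bgUnits F K U₀)) (emb y) (stairWord i.2.1 (off i.1)) : (Matrix (Fin 2) (Fin 2) ℂ)ˣ) : Matrix (Fin 2) (Fin 2) ℂ) *
          ns j (transl (emb y) (disp (stairWord i.2.1 (off i.1)))) * (((holT (emlIterU j (bgUnits F K U₀)) (emb y) (stairWord i.2.1 (off i.1)))⁻¹ : (Matrix (Fin 2) (Fin 2) ℂ)ˣ) : Matrix (Fin 2) (Fin 2) ℂ)) →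
      ns (K - n) = Q'' (toL2S F K c₀ lam)) :
    ∀ lam : Site (F.P K) 0 → Matrix (Fin 2) (Fin 2) ℂ, ∃ ns : (j : ℕ) → Site (F.P K) j → Matrix (Fin 2) (Fin 2) ℂ, ns 0 = lam ∧
      (∀ (j : ℕ) (y : Site (F.P K) (j + 1)), ns (j + 1) y = ns j (emb y) - meanCLM (Idx (F.P K)) (Matrix (Fin 2) (Fin 2) ℂ) fun i : Idx (F.P K) =>
        ns j (emb y) - ((holT (emlIterU j (bgUnits F K U₀)) (emb y) (stairWord i.2.1 (off i.1)) : (Matrix (Fin 2) (Fin 2) ℂ)ˣ) : Matrix (Fin 2) (Fin 2) ℂ) *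
          ns j (transl (emb y) (disp (stairWord i.2.1 (off i.1)))) * (((holT (emlIterU j (bgUnits F K U₀)) (emb y) (stairWord i.2.1 (off i.1)))⁻¹ : (Matrix (Fin 2) (Fin 2) ℂ)ˣ) : Matrix (Fin 2) (Fin 2) ℂ)) ∧
      ns (K - n) = Q'' (toL2S F K c₀ lam) := by
  obtain ⟨N, hN0, hNrec⟩ := Prop7NSIntertwinerOfRecord.exists_linear_avgSeq
    (fun (j : ℕ) (y : Site (F.P K) (j + 1)) (i : Idx (F.P K)) => holT (emlIterU j (bgUnits F K U₀)) (emb y) (stairWord i.2.1 (off i.1)))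
  intro lam
  exact ⟨fun j => N j lam, hN0 lam, fun j y => hNrec j lam y, htop lam (fun j => N j lam) (hN0 lam) (fun j y => hNrec j lam y)⟩

/-- ★★★ **STEP 0 OF (L5″) — THE `P`-TERM IS A GAUGE INVARIANT.**  For an `SU(2)` gauge transformation `σ`, a background `U₀`, and ANY averaging-of-record maps `Q″₀` at `U₀` and `Q″₁` at
`U₀^σ = GaugeField.gaugeAct σ U₀` (clause (iii)+(iv) of ✓`exists_intertwiner_of_regPr`), for every vector field `X`:
`‖D*_{U₀^σ}(Ad_σX)~ − projR (Δ^η_{U₀^σ}) Q″₁ (D*_{U₀^σ}(Ad_σX)~)‖ = ‖D*_{U₀}X̃ − projR (Δ^η_{U₀}) Q″₀ (D*_{U₀}X̃)‖` and the same with `projR` alone — ✓`norm_sub_projR_adjoint_conj` at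
`Φ := Ad_σ` (px12 ✓`exists_adIsometries`: `hΔ`, `hD`), `hker` from ✓`ker_eq_map_of_conj` with the coarse intertwiner `Θ_σ = Ad_{σ∘embIter(K−n)}` (✓`topMean_gaugeAct_conj`).
[cite: Balaban1985BackgroundPropagators, (3.8) p.392, (3.21) p.394, p.393; Balaban1985Averaging, (11) p.19] -/
theorem norm_Pterm_gaugeAct_eq (σ : GaugeTransf (F.P K) 0 (Matrix.specialUnitaryGroup (Fin 2) ℂ)) (U₀ : GaugeField (F.P K) 0 (Matrix.specialUnitaryGroup (Fin 2) ℂ))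
    (Q₀ : SiteL2K ℂ 3 (periodsT3 F K) c₀ W₂ →ₗ[ℂ] (Site (F.P K) (K - n) → Matrix (Fin 2) (Fin 2) ℂ))
    (hseq₀ : (∀ lam : Site (F.P K) 0 → Matrix (Fin 2) (Fin 2) ℂ, ∃ ns : (j : ℕ) → Site (F.P K) j → Matrix (Fin 2) (Fin 2) ℂ, ns 0 = lam ∧
      (∀ (j : ℕ) (y : Site (F.P K) (j + 1)), ns (j + 1) y = ns j (emb y) - meanCLM (Idx (F.P K)) (Matrix (Fin 2) (Fin 2) ℂ) fun i : Idx (F.P K) =>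
        ns j (emb y) - ((holT (emlIterU j (bgUnits F K U₀)) (emb y) (stairWord i.2.1 (off i.1)) : (Matrix (Fin 2) (Fin 2) ℂ)ˣ) : Matrix (Fin 2) (Fin 2) ℂ) *
          ns j (transl (emb y) (disp (stairWord i.2.1 (off i.1)))) * (((holT (emlIterU j (bgUnits F K U₀)) (emb y) (stairWord i.2.1 (off i.1)))⁻¹ : (Matrix (Fin 2) (Fin 2) ℂ)ˣ) : Matrix (Fin 2) (Fin 2) ℂ)) ∧
      ns (K - n) = Q₀ (toL2S F K c₀ lam)))
    (Q₁ : SiteL2K ℂ 3 (periodsT3 F K) c₀ W₂ →ₗ[ℂ] (Site (F.P K) (K - n) → Matrix (Fin 2) (Fin 2) ℂ))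
    (hseq₁ : (∀ lam : Site (F.P K) 0 → Matrix (Fin 2) (Fin 2) ℂ, ∃ ns : (j : ℕ) → Site (F.P K) j → Matrix (Fin 2) (Fin 2) ℂ, ns 0 = lam ∧
      (∀ (j : ℕ) (y : Site (F.P K) (j + 1)), ns (j + 1) y = ns j (emb y) - meanCLM (Idx (F.P K)) (Matrix (Fin 2) (Fin 2) ℂ) fun i : Idx (F.P K) =>
        ns j (emb y) - ((holT (emlIterU j (bgUnits F K (GaugeField.gaugeAct σ U₀))) (emb y) (stairWord i.2.1 (off i.1)) : (Matrix (Fin 2) (Fin 2) ℂ)ˣ) : Matrix (Fin 2) (Fin 2) ℂ) *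
          ns j (transl (emb y) (disp (stairWord i.2.1 (off i.1)))) * (((holT (emlIterU j (bgUnits F K (GaugeField.gaugeAct σ U₀))) (emb y) (stairWord i.2.1 (off i.1)))⁻¹ : (Matrix (Fin 2) (Fin 2) ℂ)ˣ) : Matrix (Fin 2) (Fin 2) ℂ)) ∧
      ns (K - n) = Q₁ (toL2S F K c₀ lam)))
    (X : PBond (F.P K) 0 → Matrix (Fin 2) (Fin 2) ℂ) :
    ‖DstarL2 F n K c₀ (GaugeField.gaugeAct σ U₀) (toL2 F K c₀ (fun b => ((σ b.src : Matrix.specialUnitaryGroup (Fin 2) ℂ) : Matrix (Fin 2) (Fin 2) ℂ) * X b * star ((σ b.src : Matrix.specialUnitaryGroup (Fin 2) ℂ) : Matrix (Fin 2) (Fin 2) ℂ)))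
        - projR (covLapSite F n K c₀ (GaugeField.gaugeAct σ U₀)) Q₁
          (DstarL2 F n K c₀ (GaugeField.gaugeAct σ U₀) (toL2 F K c₀ (fun b => ((σ b.src : Matrix.specialUnitaryGroup (Fin 2) ℂ) : Matrix (Fin 2) (Fin 2) ℂ) * X b * star ((σ b.src : Matrix.specialUnitaryGroup (Fin 2) ℂ) : Matrix (Fin 2) (Fin 2) ℂ))))‖
      = ‖DstarL2 F n K c₀ U₀ (toL2 F K c₀ X) - projR (covLapSite F n K c₀ U₀) Q₀ (DstarL2 F n K c₀ U₀ (toL2 F K c₀ X))‖ ∧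
    ‖projR (covLapSite F n K c₀ (GaugeField.gaugeAct σ U₀)) Q₁
          (DstarL2 F n K c₀ (GaugeField.gaugeAct σ U₀) (toL2 F K c₀ (fun b => ((σ b.src : Matrix.specialUnitaryGroup (Fin 2) ℂ) : Matrix (Fin 2) (Fin 2) ℂ) * X b * star ((σ b.src : Matrix.specialUnitaryGroup (Fin 2) ℂ) : Matrix (Fin 2) (Fin 2) ℂ))))‖
      = ‖projR (covLapSite F n K c₀ U₀) Q₀ (DstarL2 F n K c₀ U₀ (toL2 F K c₀ X))‖ := by
  obtain ⟨Φ, Ψ, hΦ, hΨ, hU⟩ := exists_adIsometries F n K c₀ σ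
  obtain ⟨_, hD, hΔ⟩ := hU U₀
  -- the coarse intertwiner `Θ_σ = Ad_{σ ∘ embIter (K−n)}` on the coarse sections
  have hss : ∀ x : Site (F.P K) 0, star ((σ x : Matrix.specialUnitaryGroup (Fin 2) ℂ) : Matrix (Fin 2) (Fin 2) ℂ) * ((σ x : Matrix.specialUnitaryGroup (Fin 2) ℂ) : Matrix (Fin 2) (Fin 2) ℂ) = 1 := fun x => Matrix.mem_unitaryGroup_iff'.mp (σ x).2.1
  have hss' : ∀ x : Site (F.P K) 0, ((σ x : Matrix.specialUnitaryGroup (Fin 2) ℂ) : Matrix (Fin 2) (Fin 2) ℂ) * star ((σ x : Matrix.specialUnitaryGroup (Fin 2) ℂ) : Matrix (Fin 2) (Fin 2) ℂ) = 1 := fun x => Matrix.mem_unitaryGroup_iff.mp (σ x).2.1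
  let Θ : (Site (F.P K) (K - n) → Matrix (Fin 2) (Fin 2) ℂ) ≃ₗ[ℂ] (Site (F.P K) (K - n) → Matrix (Fin 2) (Fin 2) ℂ) :=
    { toFun := fun c y => ((σ (embIter (K - n) y) : Matrix.specialUnitaryGroup (Fin 2) ℂ) : Matrix (Fin 2) (Fin 2) ℂ) * c y * star ((σ (embIter (K - n) y) : Matrix.specialUnitaryGroup (Fin 2) ℂ) : Matrix (Fin 2) (Fin 2) ℂ)
      invFun := fun c y => star ((σ (embIter (K - n) y) : Matrix.specialUnitaryGroup (Fin 2) ℂ) : Matrix (Fin 2) (Fin 2) ℂ) * c y * ((σ (embIter (K - n) y) : Matrix.specialUnitaryGroup (Fin 2) ℂ) : Matrix (Fin 2) (Fin 2) ℂ)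
      map_add' := fun c c' => by funext y; simp only [Pi.add_apply, Matrix.mul_add, Matrix.add_mul]
      map_smul' := fun a c => by funext y; simp only [Pi.smul_apply, RingHom.id_apply, Matrix.mul_smul, Matrix.smul_mul]
      left_inv := fun c => by
        funext y
        show star _ * (_ * c y * star _) * _ = c y
        calc _ = (star ((σ (embIter (K - n) y) : Matrix.specialUnitaryGroup (Fin 2) ℂ) : Matrix (Fin 2) (Fin 2) ℂ) * ((σ (embIter (K - n) y) : Matrix.specialUnitaryGroup (Fin 2) ℂ) : Matrix (Fin 2) (Fin 2) ℂ)) * c y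
              * (star ((σ (embIter (K - n) y) : Matrix.specialUnitaryGroup (Fin 2) ℂ) : Matrix (Fin 2) (Fin 2) ℂ) * ((σ (embIter (K - n) y) : Matrix.specialUnitaryGroup (Fin 2) ℂ) : Matrix (Fin 2) (Fin 2) ℂ)) := by noncomm_ring
          _ = c y := by rw [hss, Matrix.one_mul, Matrix.mul_one]
      right_inv := fun c => by
        funext y
        show _ * (star _ * c y * _) * star _ = c y
        calc _ = (((σ (embIter (K - n) y) : Matrix.specialUnitaryGroup (Fin 2) ℂ) : Matrix (Fin 2) (Fin 2) ℂ) * star ((σ (embIter (K - n) y) : Matrix.specialUnitaryGroup (Fin 2) ℂ) : Matrix (Fin 2) (Fin 2) ℂ)) * c y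
              * (((σ (embIter (K - n) y) : Matrix.specialUnitaryGroup (Fin 2) ℂ) : Matrix (Fin 2) (Fin 2) ℂ) * star ((σ (embIter (K - n) y) : Matrix.specialUnitaryGroup (Fin 2) ℂ) : Matrix (Fin 2) (Fin 2) ℂ)) := by noncomm_ring
          _ = c y := by rw [hss', Matrix.one_mul, Matrix.mul_one] }
  have hQ : ∀ x, Q₁ (Φ x) = Θ (Q₀ x) := by
    intro x
    obtain ⟨l, rfl⟩ : ∃ l, x = toL2S F K c₀ l := ⟨(toL2S F K c₀).symm x, by rw [LinearEquiv.apply_symm_apply]⟩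
    rw [hΦ]
    funext y
    exact topMean_gaugeAct_conj F σ U₀ Q₀ hseq₀ Q₁ hseq₁ l y
  have hker := ker_eq_map_of_conj Φ Q₀ Q₁ Θ hQ
  have h := norm_sub_projR_adjoint_conj Φ (covLapSite F n K c₀ U₀) (covLapSite F n K c₀ (GaugeField.gaugeAct σ U₀)) hΔ Q₀ Q₁ hker
    (DstarL2 F n K c₀ U₀) (DstarL2 F n K c₀ (GaugeField.gaugeAct σ U₀)) Ψ hD (toL2 F K c₀ X)
  rw [hΨ] at h
  exact h

/-! ## §2 The (L5″) row of Step I.2 modulo the local projector row -/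

/-- ★★★ **PEN (L5″), THE KNIT — THE `P`-TERM UNDER THE LOCAL GAUGE COMPARISON (Step I.2 of LOCATE-L6-ASSEMBLY, RELATIVE currency).**  DATA: `σ` (member: a global
extension of the axial gauge of the cube `□̃_j`), `W := U₀^σ` with `‖W(b) − 1‖ ≤ δ` on every bond where `X ≠ 0` (member: `δ = 2R″ε₀η`, [B6] Lemma 1), averaging-of-record maps
`Q″₀` at `U₀`, `Q″₁` at `W`, `Q″_f` at the flat background `1`, and THE ONE ANALYTIC INPUT — the local projector row (R-P) at `(W, 1)` on the vector `f := D*_W(Ad_σX)~`: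
`‖⟪f, (f − R_W f) − (f − R_1 f)⟫‖ ≤ δ_P‖f‖²` (✓`Prop7ProjectorPerturbationLocal.norm_inner_proj_sub_proj_le` fed by (R-B)(R-N)).  CONCLUSION, for every `θ > 0`:
**`|‖D*_{U₀}X̃ − R_{U₀}(D*_{U₀}X̃)‖² − ‖∂*(Ad_σX)~ − R_1(∂*(Ad_σX)~)‖²| ≤ (δ_P + θ)·‖D*_{U₀}X̃‖² + (1 + θ⁻¹)·(12·η⁻²·δ²)·‖X̃‖²`** — Step 0 (§1) moves to `W`, ✓`abs_re_inner_sub_le_relative`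
with `‖D*_WỸ − ∂*Ỹ‖ ≤ √12·η⁻¹δ·‖Ỹ‖` (px12 ✓`normSq_DstarL2_sub_DstarL2_one_le`), `‖Ỹ‖ = ‖X̃‖`; then Step I.4 (✓`Prop7RTermFloor` v2 §3) trades `‖D*_{U₀}X̃‖²`.
[cite: Balaban1985BackgroundPropagators, (3.8) p.392, (3.20)–(3.23) p.394, (3.49) p.399; Balaban1985RegularSpaces, Lemma 1 (1.25) p.79] -/
theorem abs_normSq_Pterm_sub_flat_le (σ : GaugeTransf (F.P K) 0 (Matrix.specialUnitaryGroup (Fin 2) ℂ)) (U₀ : GaugeField (F.P K) 0 (Matrix.specialUnitaryGroup (Fin 2) ℂ))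
    (Q₀ : SiteL2K ℂ 3 (periodsT3 F K) c₀ W₂ →ₗ[ℂ] (Site (F.P K) (K - n) → Matrix (Fin 2) (Fin 2) ℂ))
    (hseq₀ : (∀ lam : Site (F.P K) 0 → Matrix (Fin 2) (Fin 2) ℂ, ∃ ns : (j : ℕ) → Site (F.P K) j → Matrix (Fin 2) (Fin 2) ℂ, ns 0 = lam ∧
      (∀ (j : ℕ) (y : Site (F.P K) (j + 1)), ns (j + 1) y = ns j (emb y) - meanCLM (Idx (F.P K)) (Matrix (Fin 2) (Fin 2) ℂ) fun i : Idx (F.P K) =>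
        ns j (emb y) - ((holT (emlIterU j (bgUnits F K U₀)) (emb y) (stairWord i.2.1 (off i.1)) : (Matrix (Fin 2) (Fin 2) ℂ)ˣ) : Matrix (Fin 2) (Fin 2) ℂ) *
          ns j (transl (emb y) (disp (stairWord i.2.1 (off i.1)))) * (((holT (emlIterU j (bgUnits F K U₀)) (emb y) (stairWord i.2.1 (off i.1)))⁻¹ : (Matrix (Fin 2) (Fin 2) ℂ)ˣ) : Matrix (Fin 2) (Fin 2) ℂ)) ∧
      ns (K - n) = Q₀ (toL2S F K c₀ lam)))
    (Q₁ : SiteL2K ℂ 3 (periodsT3 F K) c₀ W₂ →ₗ[ℂ] (Site (F.P K) (K - n) → Matrix (Fin 2) (Fin 2) ℂ))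
    (hseq₁ : (∀ lam : Site (F.P K) 0 → Matrix (Fin 2) (Fin 2) ℂ, ∃ ns : (j : ℕ) → Site (F.P K) j → Matrix (Fin 2) (Fin 2) ℂ, ns 0 = lam ∧
      (∀ (j : ℕ) (y : Site (F.P K) (j + 1)), ns (j + 1) y = ns j (emb y) - meanCLM (Idx (F.P K)) (Matrix (Fin 2) (Fin 2) ℂ) fun i : Idx (F.P K) =>
        ns j (emb y) - ((holT (emlIterU j (bgUnits F K (GaugeField.gaugeAct σ U₀))) (emb y) (stairWord i.2.1 (off i.1)) : (Matrix (Fin 2) (Fin 2) ℂ)ˣ) : Matrix (Fin 2) (Fin 2) ℂ) *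
          ns j (transl (emb y) (disp (stairWord i.2.1 (off i.1)))) * (((holT (emlIterU j (bgUnits F K (GaugeField.gaugeAct σ U₀))) (emb y) (stairWord i.2.1 (off i.1)))⁻¹ : (Matrix (Fin 2) (Fin 2) ℂ)ˣ) : Matrix (Fin 2) (Fin 2) ℂ)) ∧
      ns (K - n) = Q₁ (toL2S F K c₀ lam)))
    (Qf : SiteL2K ℂ 3 (periodsT3 F K) c₀ W₂ →ₗ[ℂ] (Site (F.P K) (K - n) → Matrix (Fin 2) (Fin 2) ℂ))
    (X : PBond (F.P K) 0 → Matrix (Fin 2) (Fin 2) ℂ) {δ δP θ : ℝ} (hδ : 0 ≤ δ) (hθ : 0 < θ)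
    (hW : ∀ b : PBond (F.P K) 0, X b ≠ 0 → ‖((GaugeField.gaugeAct σ U₀ b : Matrix.specialUnitaryGroup (Fin 2) ℂ) : Matrix (Fin 2) (Fin 2) ℂ) - 1‖ ≤ δ)
    (hloc : ‖⟪DstarL2 F n K c₀ (GaugeField.gaugeAct σ U₀) (toL2 F K c₀ (fun b => ((σ b.src : Matrix.specialUnitaryGroup (Fin 2) ℂ) : Matrix (Fin 2) (Fin 2) ℂ) * X b * star ((σ b.src : Matrix.specialUnitaryGroup (Fin 2) ℂ) : Matrix (Fin 2) (Fin 2) ℂ))),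
        (DstarL2 F n K c₀ (GaugeField.gaugeAct σ U₀) (toL2 F K c₀ (fun b => ((σ b.src : Matrix.specialUnitaryGroup (Fin 2) ℂ) : Matrix (Fin 2) (Fin 2) ℂ) * X b * star ((σ b.src : Matrix.specialUnitaryGroup (Fin 2) ℂ) : Matrix (Fin 2) (Fin 2) ℂ)))
          - projR (covLapSite F n K c₀ (GaugeField.gaugeAct σ U₀)) Q₁
            (DstarL2 F n K c₀ (GaugeField.gaugeAct σ U₀) (toL2 F K c₀ (fun b => ((σ b.src : Matrix.specialUnitaryGroup (Fin 2) ℂ) : Matrix (Fin 2) (Fin 2) ℂ) * X b * star ((σ b.src : Matrix.specialUnitaryGroup (Fin 2) ℂ) : Matrix (Fin 2) (Fin 2) ℂ)))))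
        - (DstarL2 F n K c₀ (GaugeField.gaugeAct σ U₀) (toL2 F K c₀ (fun b => ((σ b.src : Matrix.specialUnitaryGroup (Fin 2) ℂ) : Matrix (Fin 2) (Fin 2) ℂ) * X b * star ((σ b.src : Matrix.specialUnitaryGroup (Fin 2) ℂ) : Matrix (Fin 2) (Fin 2) ℂ)))
          - projR (covLapSite F n K c₀ 1) Qf
            (DstarL2 F n K c₀ (GaugeField.gaugeAct σ U₀) (toL2 F K c₀ (fun b => ((σ b.src : Matrix.specialUnitaryGroup (Fin 2) ℂ) : Matrix (Fin 2) (Fin 2) ℂ) * X b * star ((σ b.src : Matrix.specialUnitaryGroup (Fin 2) ℂ) : Matrix (Fin 2) (Fin 2) ℂ)))))⟫_ℂ‖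
      ≤ δP * ‖DstarL2 F n K c₀ (GaugeField.gaugeAct σ U₀) (toL2 F K c₀ (fun b => ((σ b.src : Matrix.specialUnitaryGroup (Fin 2) ℂ) : Matrix (Fin 2) (Fin 2) ℂ) * X b * star ((σ b.src : Matrix.specialUnitaryGroup (Fin 2) ℂ) : Matrix (Fin 2) (Fin 2) ℂ)))‖ ^ 2) :
    |‖DstarL2 F n K c₀ U₀ (toL2 F K c₀ X) - projR (covLapSite F n K c₀ U₀) Q₀ (DstarL2 F n K c₀ U₀ (toL2 F K c₀ X))‖ ^ 2
        - ‖DstarL2 F n K c₀ 1 (toL2 F K c₀ (fun b => ((σ b.src : Matrix.specialUnitaryGroup (Fin 2) ℂ) : Matrix (Fin 2) (Fin 2) ℂ) * X b * star ((σ b.src : Matrix.specialUnitaryGroup (Fin 2) ℂ) : Matrix (Fin 2) (Fin 2) ℂ)))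
            - projR (covLapSite F n K c₀ 1) Qf (DstarL2 F n K c₀ 1 (toL2 F K c₀ (fun b => ((σ b.src : Matrix.specialUnitaryGroup (Fin 2) ℂ) : Matrix (Fin 2) (Fin 2) ℂ) * X b * star ((σ b.src : Matrix.specialUnitaryGroup (Fin 2) ℂ) : Matrix (Fin 2) (Fin 2) ℂ))))‖ ^ 2|
      ≤ (δP + θ) * ‖DstarL2 F n K c₀ U₀ (toL2 F K c₀ X)‖ ^ 2 + (1 + θ⁻¹) * (12 * ((eta F n K)⁻¹) ^ 2 * δ ^ 2) * ‖toL2 F K c₀ X‖ ^ 2 := by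
  -- letters
  set W := GaugeField.gaugeAct σ U₀ with hWdef
  set Xσ : PBond (F.P K) 0 → Matrix (Fin 2) (Fin 2) ℂ := fun b => ((σ b.src : Matrix.specialUnitaryGroup (Fin 2) ℂ) : Matrix (Fin 2) (Fin 2) ℂ) * X b * star ((σ b.src : Matrix.specialUnitaryGroup (Fin 2) ℂ) : Matrix (Fin 2) (Fin 2) ℂ) with hXσ
  set f : SiteL2K ℂ 3 (periodsT3 F K) c₀ W₂ := DstarL2 F n K c₀ W (toL2 F K c₀ Xσ) with hf
  set f' : SiteL2K ℂ 3 (periodsT3 F K) c₀ W₂ := DstarL2 F n K c₀ 1 (toL2 F K c₀ Xσ) with hf'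
  -- Step 0: move the `U₀`-terms to `W`
  obtain ⟨hP0, _⟩ := norm_Pterm_gaugeAct_eq F c₀ σ U₀ Q₀ hseq₀ Q₁ hseq₁ X
  have hD0 : ‖DstarL2 F n K c₀ U₀ (toL2 F K c₀ X)‖ = ‖f‖ := by
    rw [hf, hXσ, hWdef, Prop7LocalDivergenceComparison.norm_DstarL2_gaugeAct_conj_eq]
  rw [← hP0, hD0]
  -- the two complementary projectors as linear maps
  set P : SiteL2K ℂ 3 (periodsT3 F K) c₀ W₂ →ₗ[ℂ] SiteL2K ℂ 3 (periodsT3 F K) c₀ W₂ := LinearMap.id - projR (covLapSite F n K c₀ W) Q₁ with hPdef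
  set P' : SiteL2K ℂ 3 (periodsT3 F K) c₀ W₂ →ₗ[ℂ] SiteL2K ℂ 3 (periodsT3 F K) c₀ W₂ := LinearMap.id - projR (covLapSite F n K c₀ 1) Qf with hP'def
  have hPap : ∀ g, P g = g - projR (covLapSite F n K c₀ W) Q₁ g := fun g => rfl
  have hP'ap : ∀ g, P' g = g - projR (covLapSite F n K c₀ 1) Qf g := fun g => rfl
  -- closeness of the divergences on the support
  have hsupp : ∀ b : PBond (F.P K) 0, Xσ b ≠ 0 → ‖((W b : Matrix.specialUnitaryGroup (Fin 2) ℂ) : Matrix (Fin 2) (Fin 2) ℂ) - 1‖ ≤ δ := by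
    intro b hb
    refine hW b fun h0 => hb ?_
    simp [hXσ, h0]
  have hclose := normSq_DstarL2_sub_DstarL2_one_le F n K c₀ W Xσ hsupp
  have hη : 0 < eta F n K := eta_pos F n K
  have hκ : 0 ≤ Real.sqrt 12 * (eta F n K)⁻¹ * δ := by positivity
  have hff' : ‖f - f'‖ ≤ (Real.sqrt 12 * (eta F n K)⁻¹ * δ) * ‖toL2 F K c₀ X‖ := by
    have h0 : 0 ≤ (Real.sqrt 12 * (eta F n K)⁻¹ * δ) * ‖toL2 F K c₀ X‖ := by positivity
    refine (pow_le_pow_iff_left₀ (norm_nonneg _) h0 two_ne_zero).1 ?_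
    rw [hf, hf', ← norm_toL2_conj_eq F K c₀ σ X]
    calc _ ≤ 12 * ((eta F n K)⁻¹) ^ 2 * δ ^ 2 * ‖toL2 F K c₀ Xσ‖ ^ 2 := hclose
      _ = (Real.sqrt 12 * (eta F n K)⁻¹ * δ * ‖toL2 F K c₀ Xσ‖) ^ 2 := by
          rw [mul_pow, mul_pow, mul_pow, Real.sq_sqrt (by norm_num : (0:ℝ) ≤ 12)]
  -- the relative-currency step of ✓`Prop7ProjectorPerturbationLocal`
  have hloc' : ‖⟪f, P f - P' f⟫_ℂ‖ ≤ δP * ‖f‖ ^ 2 := by rw [hPap, hP'ap]; exact hloc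
  have hrel := abs_re_inner_sub_le_relative P P' (fun x => by rw [hP'ap]; exact norm_sub_projR_le _ _ x) f f' hκ (norm_nonneg (toL2 F K c₀ X)) hθ hloc' hff'
  rw [hPap, hP'ap, re_inner_sub_projR_eq_normSq, re_inner_sub_projR_eq_normSq] at hrel
  calc _ ≤ (δP + θ) * ‖f‖ ^ 2 + (1 + θ⁻¹) * (Real.sqrt 12 * (eta F n K)⁻¹ * δ) ^ 2 * ‖toL2 F K c₀ X‖ ^ 2 := hrel
    _ = (δP + θ) * ‖f‖ ^ 2 + (1 + θ⁻¹) * (12 * ((eta F n K)⁻¹) ^ 2 * δ ^ 2) * ‖toL2 F K c₀ X‖ ^ 2 := by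
        rw [mul_pow, mul_pow, Real.sq_sqrt (by norm_num : (0:ℝ) ≤ 12)]

end Member

end Summit.QuantumFields.YangMills.Theorems.Prop7PTermLocalGaugeKnit

end
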